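import Summits.FinalStateConjecture.FinalStateConjecture.Theses.StarvedNecks
import Summits.FinalStateConjecture.FinalStateConjecture.Theorems.NecksCertify.Negative.NecksCertifyFalseOfEqualVelocityBinaryWitness
import Summits.FinalStateConjecture.FinalStateConjecture.Theorems.NecksCertify.Negative.NoParkingDecaySharp

/-!
# Disproof of `NecksCertify` — findings (cdisprove seats, crux stmt-FinalStateConjecture-13549)

Refuter seats `refuter-cdisprove-stmt-FinalStateConjecture-13549-0` (generation 1, 2026-08-16,
§1–§4, §A–§D), `refuter-cdisprove-stmt-FinalStateConjecture-13549-g2-0` (generation 2,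
2026-08-16, §5, §T, §E, §F) and `refuter-cdisprove-stmt-FinalStateConjecture-13549-g3-0`
(generation 3, 2026-08-16, §G at the end; summary just below), route `StarvedNecks`.  Everything below the module docstring is
`sorry`-free and `lean check`ed (rc 0; axioms `propext`, `Classical.choice`, `Quot.sound`).  Prose
lives in docstrings/comments.

## Generation 3, cycle 1 — what is new (read this first; details in §G at the end of the file)

Seat `refuter-cdisprove-stmt-FinalStateConjecture-13549-g3-0`, 2026-08-16.  Three kernel-checked
results (rc 0, axioms `propext`·`Classical.choice`·`Quot.sound`; landing as five `Negative/` files,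
proposal ids in the seat's NOTES.md / item notes once the gate returns them):

* (G1) **SEAMED ⇒ UNBOUNDED FLAT TUBES.**  `excision_tendsto_atTop_of_seamed`
  (`Negative/SeamedExcisionUnbounded.lean`, toolkit `Negative/SeamedOneAtlasDeviation.lean`): for
  EVERY `FinalStateDecomposition d` (any `Cᵏ`) and radii `R, R₀` with `Hc`(1) (`100·Mᵢ ≤ R₀`,
  orthochronous) and, out of `Sm`, S1 (continuity of `Rᵢ`, `ρᵢ ≥ R₀`), S6 ONE ATLAS, S7, S8, S12:
  `∀ j, Tendsto (d.excision j) atTop atTop`.  Mechanism: if `ρⱼ(s) < b` at a late flat time `s`,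
  just outside the wall on the pushed spin axis of hole `j` there is an S6-eligible OPEN set (S8 room
  `Rⱼ ≥ ρⱼ + 2`, continuity of `Rⱼ`, S8 + S12 keep other tubes away, S7 makes it open); there
  `Ψⱼ = Φ`, so (`d(inclusion) = id`) `dev Φ − dev Ψⱼ = g_{Bⱼ} − η`, whose `(Λⱼ∂₀, Λⱼ∂₀)` component
  is `2H = 2Mⱼλ/(λ² + aⱼ²) ≥ 2MⱼR₀/((b+1)² + aⱼ²) > 0`, against near-zone convergence of `Ψⱼ` at
  the fixed radius `b + 1` and whole-slab convergence of `Φ` (STRUCTURE fields, not `Sm`).  So the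
  growth hypothesis of §2's `false_of_parallel_boosts_of_tendsto` is AUTOMATIC.
* (G2) **`¬ NecksCertify` MODULO A COMOVING PAIR ONLY.**  `ComovingPairWitness` (`H′` := gen 1's
  `H = EqualVelocityBinaryWitness` with the conjunct "all excision radii → ∞" DELETED) and
  `NecksCertify_false_of_ComovingPairWitness : H′ → ¬ NecksCertify`,
  `comovingPairWitness_of_equalVelocityBinaryWitness : H → H′`
  (`Negative/NecksCertifyFalseOfComovingPairWitness.lean`, negative lemma modulo `H′`).  The ONLY
  physics left in the comoving defect is label rigidity: an admissible MGHD whose honest seamed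
  re-decompositions all carry two labels with `Λᵢ∂₀ = Λⱼ∂₀` (threshold "parabolic" binary).
* (G3) **M2's THRESHOLD IS EXACTLY `1`.**  `not_noParkingDecayUpTo_of_one_lt : 1 < η₀ →
  ¬ NoParkingDecayUpTo η₀` and `noParkingDecayUpTo_threshold : NoParkingDecayUpTo η₀ → η₀ ≤ 1`
  (`Negative/NoParkingThresholdOne.lean`, toolkit `Negative/NoParkingShelf.lean`), closing the gap
  `(1, 2 log 2]` left by gen 2: the SHELF resonance `ψ = prof K r` (`= r/K` up to `r = K`, bending
  smoothly over unit width to a constant — the δ-shell resonance `min(r/K,1)` smoothed), thin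
  attractive shell `V = ψ''/ψ` in `K ≤ r ≤ K+1`, majorant `ν = S'(r−K)/K` of Bargmann norm
  `≤ (K+1)/K`, free field vanishing IDENTICALLY for `t − r ≥ K + 1`, parked value `ψ(t,K) = 1`;
  `K = max 1 (1/(η₀−1))`.  Consequence for N1 unchanged but now sharp: per-mode use of the lever needs
  `η_ℓ < 1` exactly.
* Re-audits with no finding (gen 3): R2 `CharacteristicCalculus` endpoint data facts (TRUE: the
  two-sided `deriv` of a `C¹` slice vanishing on a closed half-line vanishes at the endpoint); the
  `N = 0` restriction witness of §A (S3 from `tendsto_deviationCk_flat`, S11 = `Hf`(2), covering via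
  `Hf`(1)); MGHD maximality is available only modulo the named fact
  `choquetBruhat_geroch_exists_mghd_cauchy`, and even with it `N = 0` gives no kill — verdict of §A
  stands: NO UNCONDITIONAL `¬` is attainable in the tree.

## Generation 2, cycle 1 — what is new (read this first; details in §T, §E, §F at the end of the file)

* LANDED / PROPOSED negative lemmas (namespace `…Theorems.NecksCertify.Negative`):
  gen 1: `NecksCertifyFalseOfEqualVelocityBinaryWitness.lean` (p73407, ACCEPTED) — `H → ¬NecksCertify`
  for `H = EqualVelocityBinaryWitness`; gen 2: `Negative/NoParkingResonance.lean` (toolkit: the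
  Pöschl–Teller zero-energy resonance `th = sinh/cosh`, Bargmann norm `∫₀^∞ 2s sech² s ds = 2 log 2`)
  and `Negative/NoParkingDecaySharp.lean` (`NoParkingDecay` verbatim, `NoParkingDecayUpTo η₀`,
  `not_noParkingDecayUpTo_two_mul_log_two : ¬ NoParkingDecayUpTo (2 * Real.log 2)`) — p75778 and
  p76706, both ACCEPTED 2026-08-16; all three landed files are IMPORTED here and re-exported as
  `example`s in §6, so every negative fact this workfile cites is one `exact` away.
* §T TARGETS = the six registered stubs of the picked line `Lines/bargmann-small-late-exterior.lean`
  (skeleton 7cb29291…): R1 `stub_tonelliBargmann`, R2 `stub_characteristicCalculus`,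
  M1 `stub_bargmannSupContraction`, M2 `stub_noParkingDecay` are TRUE as registered (paper proofs
  re-derived line by line, §T.1–§T.4, with two UNNECESSARY hypotheses flagged in M1/M2: `0 ≤ R₀` and
  the a-priori bound `∃ P`); M2's threshold `η < 1` is SHARP up to `2 log 2` (kernel-checked:
  `not_noParkingDecayUpTo_two_mul_log_two`, the parked resonance `ψ = tanh r` of the well
  `V = −2 sech² r`), so the high-`ℓ` Regge–Wheeler couplings `η_ℓ = 2M(ℓ(ℓ+1)+3)/R₀ ≥ 1` (`ℓ ≥ 7` at
  `R₀ = 100M`) are outside M2's reach by a genuine obstruction, not a missing proof (§T.4);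
  N2 `stub_seamSurgery` inherits the S8+S12 comoving defect of §2–§4 verbatim (its `NeckAtlas`
  hypothesis states nothing that separates two holes), N1 `stub_lateExteriorNoParking` is the
  physics (§T.5–§T.6).  No stub is killed.
* §5 two typed consequences of `Sm` the seam's prover can cite: S7 + the structure field pin the
  late flat domain to the tube complement (`flatDomain_late_eq`), and S9 collapses the disjunction
  `τ₀ ≤ tⱼ y ∨ τ₀ ≤ y⁰` near certified tubes (`flatLate_of_holeLate`).
* §E the FAR-LEAF FOLD a boosted hole needs (hole-late/flat-early far leaves must be mapped into the
  radiation zone, S10) was re-audited against `Hc`(2) (anchoring below later discs of EVERY radius)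
  and `Hc`(3): an explicit fold exists (push along the flat time axis by `Δ⁰(s, x̄′)`, non-increasing
  in hole time no faster than `γ(1−v)`), under two satisfiable side conditions on the seam's free
  parameters — recorded with the formulas; no misstatement found.  gen 1's §C checks are confirmed
  independently (exact and boosted Schwarzschild geon meet all 4 + 3 + 12 clauses when velocities are
  pairwise distinct).
* §F the route's KILL CRITERION (a non-starving neck) is out of reach of cheap attacks: data-borne
  focusing packet trains (TRIAGE-r1-1 §B, which refute the LINEAR transfer `C⁺_lin`) are excluded for
  the crux by the admissible `o₂(r⁻¹)` fall-off plus sublinear tubes (`ω ≫ t²/κ` against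
  `ω ≪ κρ(t)`, re-derived), polynomial tails starve sublinear necks, hidden companions are excluded by
  `Hf`(3); what remains (nonlinearly generated, persistently refocused radiation) is the N1 physics.
* WHY IT RESISTS (one paragraph for the lead): structurally, `¬NecksCertify` needs an admissible datum
  WITH a maximal vacuum Cauchy development carrying an honest `N ≥ 1` decomposition, and
  `VacuumCauchyDevelopment.IsMaximal` (= every vacuum Cauchy development of the datum embeds, MGHD
  rigidity) is not provable in the tree for any constructible spacetime (§A); substantively, every
  typed clause has been instantiated on exact/boosted Kerr–Schild Schwarzschild (gen 1 §C, gen 2 §E)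
  and holds there whenever the asymptotic velocities are pairwise distinct, so the only standing
  defect is the comoving one (repair C′), already a landed negative lemma modulo `H`.

## Verdict so far

NO UNCONDITIONAL KILL is attainable in the tree, for a structural reason (§A below): the crux is an
implication whose antecedent needs an admissible datum WITH A MAXIMAL vacuum Cauchy development and
an honest `C⁴` final-state decomposition; the tree constructs exactly one vacuum Cauchy development
(`Minkowski.vacuumCauchyDevelopment`, maximality NOT proved), and in Minkowski space every honest
decomposition has `N = 0`, where the conclusion is satisfiable (restriction of the input to late
times).  A kill needs `N ≥ 1`, i.e. a black-hole MGHD — physics-level.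

ONE GENUINE DEFECT, kernel-checked here in its combinatorial core and LANDED as a negative lemma
modulo a physics hypothesis (§2–§4; proposal id in the seat's NOTES.md / item notes):
clauses S8 + S12 of `Sm` are incompatible with two distinct holes having the SAME asymptotic
four-velocity `Λⱼ∂₀ = Λⱼ'∂₀` as soon as the excision radius of one of them is unbounded
(`false_of_parallel_boosts`, `seamed_false_of_parallel_boosts`).  Paper provenance: rattack
EVIDENCE.md §3–4 (2026-08-15, item evidence), classified `refuted-misstated` there; repair C′ =
add pairwise distinct asymptotic 3-velocities to `Hc` (and to G's conclusion).  This file turns the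
typed derivation into a theorem and isolates the exact physics input `H` under which the crux AS
WRITTEN is false (`EqualVelocityBinaryWitness`, §4): threshold ("parabolic") head-on two-hole
recessions with honest charts.  The witness MISSES C′; nothing here speaks against C′.

## Index

* §1 `HonestCore`, `HonestFar`, `Seamed` — the crux's `let`-bound `Hc`, `Hf`, `Sm`, named verbatim
  (definitionally the crux's terms; the line skeletons do the same).
* §2 `false_of_parallel_boosts` (S8 + S12 + `R ≥ −1` + `Λⱼ∂₀ = Λⱼ'∂₀` + one wide flat tube ⇒
  `False`; witness point = axis of hole `j` at a flat-late time), `…_of_tendsto`.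
* §2b `parallel_boosts_consistent_with_bounded_tubes` — tightness: comoving labels with BOUNDED
  tubes meet S8, S12 and `R ≥ −1`, so the growth hypothesis of §2 cannot be dropped.
* §3 `Seamed.clauses`, `seamed_false_of_parallel_boosts` (from `Seamed d R R₀`, `R₀ ≥ −5`).
* §4 `EqualVelocityBinaryWitness` (= `H`), `necksCertify_false_of_equalVelocityBinaryWitness :
  H → ¬ NecksCertify`.  Landed copy (namespace `…Theorems.NecksCertify.Negative`, H stated over the
  crux's inline `let`s): `Theorems/NecksCertify/Negative/NecksCertifyFalseOfEqualVelocityBinaryWitness.lean`.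
* §A (this docstring) why no unconditional `¬`; §B load-bearing hypotheses; §C attacks that found
  nothing; §D briefing for provers.
* (generation 2) §5 `flatDomain_late_eq`, `flatLate_of_holeLate`; §6 index of the landed negative
  lemmas (imported, re-exported as `example`s); §T targets (stub audit of the picked line, M2
  sharpness theorem p76706); §E the far-leaf fold vs `Hc`(2)/(3); §F kill criterion.
* (generation 3) §G growth theorem (G1), `H′` (G2), threshold `1` (G3): statements, where they live,
  what they mean for N1/N2 and for the remaining physics of `H′`.

## §A  Why Minkowski / `N = 0` gives no kill (paper, checked against the typed clauses)

In `Minkowski.vacuumCauchyDevelopment` (carrier `E4`, `η`, `∂ₜ`, slice `{t = 0}`) a final-state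
decomposition in `C²` or better has `N = 0`: a hole chart would make `Ψᵢ^*η` (flat) converge in `C²`
on the compact truncated slabs `{t*ᵢ = τ, r₊ < rᵢ ≤ R}` to boosted Kerr with `Mᵢ > 0`, whose curvature
`∼ Mᵢ/r³ ≠ 0` there — impossible.  For `N = 0` the twelve `Sm` clauses collapse to S3 (flat `C⁰`
deviation `≤ 1/10` on `{y⁰ ≥ τ₀'}`) and S11 (`Φ''{y⁰ ≥ τ'}` closed for `τ' > τ₀'`), and `Hc` to its
fourth clause; given an honest input `d` (`Hc`, `Hf`), the witness `d₂ := d.ofLE` with `τ₀'` so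
late that the flat slab deviation is `≤ 1/10` from `τ₀'` on satisfies them: S11 is `Hf`(2) (its
`∀ i` is vacuous), S3 is `tendsto_deviationCk_flat`, the covering clause and `O = exteriorOf d₂.charted`
re-verify through `Hf`(1) (flat-late points lie below later flat slabs) and push-up.  So on the only
constructible development the crux is TRUE BY RESTRICTION; no junk-model refutation exists at
`N = 0`.  (Also: `trivialData ∈ admissibleVacuumData` is in the tree — `TrivialDataAdmissible.lean` —
but `Minkowski.vacuumCauchyDevelopment.IsMaximal` is not, so even the antecedent is not instantiable
sorry-free.)

## §B  Load-bearing hypotheses (paper; no `_false_without_` THEOREM is possible without a model)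

* `Hc`(1) `100·Mᵢ ≤ R₀` is used by every line as the smallness `η ≲ 2M/R₀ ≤ 1/50`; dropping it does
  not make the crux false in any model we can build (again: no model), but the conclusion's own
  `Hc`(1) at `R₀'` is free for the prover (`R₀'` is existential), so the INPUT threshold only matters
  analytically.
* `Hf`(3) (Voronoi `C⁰` honesty) is what excludes "hidden strong field" inputs; without it an input
  whose hole chart `i` is honest only near hole `i` but whose flat tubes hide a third, uncharted
  compact object would satisfy `Hc`, `Hf`(1,2) — and the conclusion would still be satisfiable by
  charting that object (if it is a Kerr hole) or impossible (if it is not Kerr-like, e.g. an extremal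
  remnant: `Kerr.IsSubextremal` in `Hc`(1) of the OUTPUT).  So `Hf`(3) + sub-extremality of the input
  are load-bearing against extremal/non-Kerr remnants; both are present.  Not checkable in Lean here.
* MISSING hypothesis (the defect): pairwise distinct asymptotic 3-velocities.  `Sm` forces it
  (§2–§3), `Hc ∧ Hf` do not supply it, and `FinalStateDecomposition` deliberately admits sublinear
  (`t^{2/3}`) drifts with equal asymptotic velocities (docstring of `tendsto_excision_div`).
  (gen 3: the auxiliary growth condition `ρⱼ → ∞` of §2 is no hypothesis at all — it follows from
  `Sm` + the structure, §G (G1).)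

## §C  Attacks that found nothing (logged so nobody repeats them)

* Quantifier/junk read-back of all 12 `Sm` clauses + 4 `Hc` + 3 `Hf` clauses (this seat, independently
  of rattack/REVIEW_R2): `10⁻¹ : ℝ≥0∞` and `ENNReal.ofReal (1/(10‖Λ‖²))` are honest thresholds; `‖Λ‖`
  is the Euclidean operator norm (`= e^{ζ}` for a boost of rapidity `ζ`, `= 1` for `Λ = 1`);
  `Kerr.radius` is total, `≥ 0`, `= 0` on the axis (used in §2); `supCkENorm _ 0` is a plain sup;
  every `∀ y : E4` clause (S8, S9, S12) was instantiated at axis points, tube walls, far leaves and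
  flat-late/hole-early points of boosted holes: with DISTINCT velocities all are met by the folded /
  clock-lagged boosted-Schwarzschild model (clock offset `c⁰ ≥ γ|v|(R(τ₀)+2+|a|) − (γ−1)τ₀`,
  `Rⱼ(t) ≥ sup_{s ≤ γt+C} ρⱼ(s) + 2`, `Rⱼ'(t) < v_rel·t − C` from S12 at the other hole's axis,
  `ρ ≥ 80M‖Λ‖⁴` so that the boosted Kerr–Schild tail `≤ 4M‖Λ‖²/ρ` fits under `1/(10‖Λ‖²)` on the
  one-atlas collar), consistent with rattack §2/§6 and REVIEW_R2.
* S9's margin `+2` exactly closes the gap between S6 (one atlas up to `R+1`) and S10 (far leaves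
  beyond `R+1` folded into the radiation zone): a hole-late point with `r ≤ R+2` is flat-late, so no
  far-leaf point near the seam has flat time `< τ₀`.  No contradiction.
* `Hc`(3) (relative closedness for EVERY continuous profile `ϱ`, however large) against folded far
  leaves: met if the fold pushes flat time to `+∞` along every sequence leaving compacta (design
  freedom of the prover).  No contradiction.
* The binder list of the crux omits `[T2Space X] [SecondCountableTopology X]` (the summit has them):
  harmless — a `DataEmbedding` makes `X` a subspace of a Hausdorff second-countable carrier.
* Literature/negatives: `ledger negatives` has 0 entries for this summit; no printed counterexample to
  annular/exterior Kerr stability on `{r ≥ 100M}` is known to this seat (the kill criterion "non-starving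
  neck", Luk–Oh nonlinear tails arXiv:2404.02220, is a research question, not kit-computable).

## §D  Briefing for provers

* Until the planner applies C′, ANY proof of `NecksCertify` must in particular refute
  `EqualVelocityBinaryWitness` (§4) — i.e. prove that no admissible MGHD with an honest `C⁴`
  decomposition has only comoving-pair seamed re-decompositions.  Do not spend cycles there; build
  `stub_seamSurgery`/N2 under the extra hypothesis "pairwise distinct `(Λᵢ∂₀)/(Λᵢ∂₀)⁰`" and let the
  planner thread it through `Hc` (same text in all three items keeps `closes` an `exact`).
* Under C′ the S12 budget is `Rⱼ'(t) < v_rel·t − C` at the other hole's axis (linear room, sublinear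
  need): choose `τ₀'` late, `R` sublinear.
* WHY C′ ON THE INPUT SIDE SUFFICES (paper, this seat): the input's labels `(Λᵢ, cᵢ)` are NOT pinned by
  any pullback clause (for every Lorentz `A`, `Ψ ∘ A` converges to the `A`-relabelled boosted Kerr
  exactly as well as `Ψ`), only by (i) tube containment — the flat chart converges outside the tubes,
  so every hole's physical track lies in a sublinear tube around SOME straight axis, which fixes that
  axis' velocity — and (ii) `Hf`(3): chart `i` is `1/(10‖Λᵢ‖²)`-near-isometric on its coordinate
  Voronoi cell beyond `R₀`, and a near-isometric embedding of a large flat coordinate ball cannot dodge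
  a second hole sitting inside that cell (degree/Jordan–Brouwer: its image ball would have to surround
  the other horizon, which bounds nothing in `O`; isometric rigidity forbids flowing around it).  Hence
  a decoy label with a fake velocity puts the other hole into the honest label's cell and violates
  `Hf`(3) at late times: for the parabolic binary EVERY honest input already has `Λ₁∂₀ = Λ₂∂₀`, so C′
  as an input hypothesis genuinely removes the witness (and G's conclusion absorbs it generically).
* NOT a repair: replacing coordinate-disjointness S12 by disjointness of the IMAGES.  Comoving holes
  drifting apart like `t^{2/3}` still cannot be seamed: one atlas (S6) makes `Ψᵢ = Φ ≈ id` on the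
  collar at coordinate radius `∼ ρᵢ`, while near the hole `Ψᵢ` must translate the straight axis onto
  the drifting track (offset `Dᵢ(t) ∼ t^{2/3}`, not removable by any straight comoving axis nor by an
  `o(1)`-strain flat chart, since the two holes need opposite displacements `∼ t^{2/3}` at mutual
  distance `∼ t^{2/3}`); `C²`-smallness of the interpolation needs `ρᵢ ≫ Dᵢ`, and then the certified
  ball `Rᵢ ≥ ρᵢ + 2 ≫ t^{2/3}` swallows the OTHER hole, killing S2.  The scope restriction C′ (or an
  explicit "asymptotic velocities pairwise distinct" clause on the development) is the honest fix.
-/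

noncomputable section

open scoped Manifold ContDiff Topology ENNReal
open Filter Set Literature.Geometry.Lorentzian

namespace Summit.FinalStateConjecture.FinalStateConjecture.Cruxes.NecksCertify.Disproof

set_option linter.dupNamespace false

/-! ## §1 The crux's bundles, named (verbatim) -/

/-- `HonestCore 𝓢 O k d R₀` = the crux's `Hc` (verbatim): sub-extremal holes, `100·Mᵢ ≤ R₀`,
orthochronous boosts; anchoring of hole-late points below later discs of every radius `≥ R₀`;
relative closedness of late tube portions; future-oriented flat chart. -/
def HonestCore (𝓢 : Spacetime.{0} 4) (O : Set 𝓢.carrier) (k : ℕ) (d : FinalStateDecomposition 𝓢 O k)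
    (R₀ : ℝ) : Prop :=
  let B := d.background; let t := fun i ↦ (B i).time; let r := fun i ↦ (B i).radius; let Ψ := d.chart;
  (∀ i, Kerr.IsSubextremal (d.mass i) (d.spin i) ∧ 100 * d.mass i ≤ R₀ ∧ 0 < ((d.motion i).1 : E4 ≃L[ℝ] E4) (E4.basisVector 0) 0) ∧
    (∀ i (ϱ τ₂ : ℝ), R₀ ≤ ϱ → d.τ₀ < τ₂ → Ψ i '' {x | d.τ₀ < t i x.1 ∧ t i x.1 < τ₂ ∧ r i x.1 < ϱ} ⊆ 𝓢.metric.causalPast 𝓢.timeOrientation (Ψ i '' (B i).truncTimeSlab ϱ τ₂)) ∧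
    (∀ i (τ' : ℝ) (ϱ : ℝ → ℝ), Continuous ϱ → d.τ₀ < τ' → let A := Ψ i '' {x | τ' ≤ t i x.1 ∧ r i x.1 ≤ ϱ (t i x.1)}; closure A ∩ O ⊆ A) ∧
    (∀ y : d.flatDomain, d.τ₀ < y.1 0 → 𝓢.timeOrientation.IsFutureDirected (mfderiv 𝓘(ℝ, E4) (𝓡 4) d.flatChart y (E4.basisVector 0)))

/-- `HonestFar 𝓢 O k d R₀` = the crux's `Hf` (verbatim): flat-late points below later flat slabs;
closures of far flat slabs are flat points; eventually each hole chart is `C⁰`-honest on its own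
coordinate Voronoi cell beyond `R₀`. -/
def HonestFar (𝓢 : Spacetime.{0} 4) (O : Set 𝓢.carrier) (k : ℕ) (d : FinalStateDecomposition 𝓢 O k)
    (R₀ : ℝ) : Prop :=
  let B := d.background; let t := fun i ↦ (B i).time; let r := fun i ↦ (B i).radius; let Φ := d.flatChart;
  (∀ τ₂ : ℝ, d.τ₀ < τ₂ → Φ '' {y | d.τ₀ < y.1 0 ∧ y.1 0 < τ₂} ⊆ 𝓢.metric.causalPast 𝓢.timeOrientation (Φ '' (Minkowski.backgroundOn d.flatDomain).timeSlab τ₂)) ∧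
    (∀ τ' : ℝ, d.τ₀ < τ' → closure (Φ '' {y | τ' ≤ y.1 0 ∧ ∀ i, d.excision i (y.1 0) + 1 ≤ r i y.1}) ⊆ Φ '' {y | τ' ≤ y.1 0}) ∧
    (∀ i, ∃ T : ℝ, supCkENorm (Subtype.val '' {x : (B i).domain | T ≤ t i x.1 ∧ R₀ ≤ r i x.1 ∧ ∀ j, j ≠ i → r i x.1 ≤ r j x.1}) 0 (𝓢.deviationExtend (B i) (d.chart i)) ≤ ENNReal.ofReal (1 / (10 * ‖(((d.motion i).1 : E4 ≃L[ℝ] E4) : E4 →L[ℝ] E4)‖ ^ 2)))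

/-- `Seamed 𝓢 O d R R₀` = the crux's `Sm` (verbatim, clauses S1–S12 in order): radii and tube
profiles (S1); `C²` certification out to `Rᵢ(τ)` (S2); flat `C⁰` threshold (S3); hole `C⁰`
threshold (S4) and future-directed hole time-lines (S5) on certified tubes; ONE ATLAS (S6);
flat-late domain inside the tube complement (S7); flat tubes with margin `2` inside certified tubes
(S8); clock lag (S9); far hole leaves in the radiation zone (S10); closures (S11); certified tubes
`+1` of different holes coordinate-disjoint (S12). -/
def Seamed (𝓢 : Spacetime.{0} 4) (O : Set 𝓢.carrier) (d : FinalStateDecomposition 𝓢 O 2)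
    (R : Fin d.N → ℝ → ℝ) (R₀ : ℝ) : Prop :=
  let B := d.background; let t := fun i ↦ (B i).time; let r := fun i ↦ (B i).radius; let Λ := fun i ↦ ((d.motion i).1 : E4 ≃L[ℝ] E4); let Φ := d.flatChart; let Ψ := d.chart; let ρ := d.excision;
  (∀ i, Monotone (R i) ∧ Continuous (R i) ∧ ∀ s, R₀ + 4 ≤ R i s ∧ R₀ ≤ ρ i s) ∧
    (∀ i, Tendsto (fun τ ↦ 𝓢.truncDeviationCk (B i) (Ψ i) 2 (R i τ) τ) atTop (𝓝 0)) ∧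
    supCkENorm (Subtype.val '' {y : d.flatDomain | d.τ₀ ≤ y.1 0}) 0 (𝓢.deviationExtend (Minkowski.backgroundOn d.flatDomain) Φ) ≤ 10⁻¹ ∧
    (∀ i, supCkENorm (Subtype.val '' {x : (B i).domain | (d.τ₀ ≤ t i x.1 ∨ d.τ₀ ≤ x.1 0) ∧ R₀ ≤ r i x.1 ∧ r i x.1 ≤ R i (t i x.1)}) 0 (𝓢.deviationExtend (B i) (Ψ i)) ≤ ENNReal.ofReal (1 / (10 * ‖(Λ i : E4 →L[ℝ] E4)‖ ^ 2))) ∧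
    (∀ i (x : (B i).domain), (d.τ₀ ≤ t i x.1 ∨ d.τ₀ ≤ x.1 0) → R₀ ≤ r i x.1 → r i x.1 ≤ R i (t i x.1) → 𝓢.timeOrientation.IsFutureDirected (mfderiv 𝓘(ℝ, E4) (𝓡 4) (Ψ i) x ((Λ i) (E4.basisVector 0)))) ∧
    (∀ i (y : E4) (hy : y ∈ (B i).domain), d.τ₀ ≤ y 0 → (∀ j, ρ j (y 0) < r j y) → r i y ≤ R i (t i y) + 1 → ∃ hy' : y ∈ d.flatDomain, Ψ i ⟨y, hy⟩ = Φ ⟨y, hy'⟩) ∧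
    (∀ y : d.flatDomain, d.τ₀ ≤ y.1 0 → ∀ j, ρ j (y.1 0) < r j y.1) ∧
    (∀ j (y : E4), d.τ₀ ≤ y 0 → r j y ≤ ρ j (y 0) → r j y + 2 ≤ R j (t j y)) ∧
    (∀ j (y : E4), d.τ₀ ≤ t j y → r j y ≤ R j (t j y) + 2 → t j y ≤ y 0) ∧
    (∀ j, Ψ j '' {x | d.τ₀ < t j x.1 ∧ R j (t j x.1) + 1 < r j x.1} ⊆ d.radiationZone) ∧
    (∀ τ' : ℝ, d.τ₀ < τ' → closure (Φ '' {y | τ' ≤ y.1 0}) ⊆ Φ '' {y | τ' ≤ y.1 0} ∪ ⋃ j, Ψ j '' {x | τ' ≤ x.1 0 ∧ r j x.1 = ρ j (x.1 0)}) ∧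
    (∀ j j' (y : E4), j ≠ j' → (d.τ₀ ≤ y 0 ∨ d.τ₀ ≤ t j y) → r j y ≤ R j (t j y) + 1 → R j' (t j' y) + 1 < r j' y)

/-! ## §2 Coordinate geometry: S8 + S12 exclude comoving holes -/

/-- The Kerr–Schild radius is invariant under translations along the time axis `∂₀`
(it depends on the spatial coordinates only). -/
theorem kerr_radius_add_smul_basisVector_zero (a s : ℝ) (w : E4) :
    Kerr.radius a (s • E4.basisVector 0 + w) = Kerr.radius a w := by
  have h1 : E4.spatialNorm (s • E4.basisVector 0 + w) = E4.spatialNorm w := by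
    unfold E4.spatialNorm
    congr 1
    ext i
    simp [E4.spatial_apply, Fin.succ_ne_zero]
  have h2 : (s • E4.basisVector 0 + w) 3 = w 3 := by simp
  unfold Kerr.radius
  rw [h1, h2]

/-- The Kerr–Schild radius vanishes on the time axis. -/
theorem kerr_radius_smul_basisVector_zero (a s : ℝ) :
    Kerr.radius a (s • E4.basisVector 0) = 0 := by
  have h1 : E4.spatialNorm (s • E4.basisVector 0 : E4) = 0 := by
    unfold E4.spatialNorm
    rw [norm_eq_zero]
    ext i
    simp [E4.spatial_apply, Fin.succ_ne_zero]
  have h2 : (s • E4.basisVector 0 : E4) 3 = 0 := by simp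
  unfold Kerr.radius
  rw [h1, h2]
  have h3 : ((0 : ℝ) ^ 2 - a ^ 2) ^ 2 + 4 * a ^ 2 * (0 : ℝ) ^ 2 = (a ^ 2) ^ 2 := by ring
  rw [h3, Real.sqrt_sq (sq_nonneg a)]
  have h4 : ((0 : ℝ) ^ 2 - a ^ 2 + a ^ 2) / 2 = 0 := by ring
  rw [h4, Real.sqrt_zero]

/-- The time component of `Λ ∂₀` does not vanish for a Lorentz transformation `Λ`
(`η(Λ∂₀, Λ∂₀) = −1`). -/
theorem lorentz_basisVector_zero_apply_zero_ne_zero (Λ : lorentzGroup) :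
    ((Λ : E4 ≃L[ℝ] E4) (E4.basisVector 0)) 0 ≠ 0 := by
  intro h0
  have h := Λ.2 (E4.basisVector 0) (E4.basisVector 0)
  rw [Minkowski.bilin_basisVector_zero, Minkowski.bilin_apply, h0] at h
  have hnn : (0 : ℝ) ≤ ∑ i : Fin 3, ((Λ : E4 ≃L[ℝ] E4) (E4.basisVector 0)) i.succ *
      ((Λ : E4 ≃L[ℝ] E4) (E4.basisVector 0)) i.succ :=
    Finset.sum_nonneg fun i _ ↦ mul_self_nonneg _
  linarith

/-- **Core negative lemma (coordinate geometry of the SEAMED tubes).** Clauses S8 (flat tubes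
lie deep inside the certified tubes) and S12 (certified tubes of different holes are
coordinate-disjoint) of `Sm`, together with `R ≥ −1`, are incompatible with two distinct holes
`j ≠ j'` having the SAME asymptotic four-velocity `Λⱼ∂₀ = Λⱼ'∂₀` as soon as the flat tube of `j'`
at some flat-late time `T` is at least as wide as the (time-independent) `j'`-radius of the axis of
`j`. Witness point: the point of the axis of hole `j` at flat time `T`. -/
theorem false_of_parallel_boosts {𝓢 : Spacetime.{0} 4} {O : Set 𝓢.carrier}
    (d : FinalStateDecomposition 𝓢 O 2) (R : Fin d.N → ℝ → ℝ)
    (hR : ∀ j s, -1 ≤ R j s)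
    (S8 : ∀ j (y : E4), d.τ₀ ≤ y 0 → (d.background j).radius y ≤ d.excision j (y 0) →
      (d.background j).radius y + 2 ≤ R j ((d.background j).time y))
    (S12 : ∀ j j' (y : E4), j ≠ j' → (d.τ₀ ≤ y 0 ∨ d.τ₀ ≤ (d.background j).time y) →
      (d.background j).radius y ≤ R j ((d.background j).time y) + 1 →
      R j' ((d.background j').time y) + 1 < (d.background j').radius y)
    {j j' : Fin d.N} (hne : j ≠ j')
    (hpar : ((d.motion j).1 : E4 ≃L[ℝ] E4) (E4.basisVector 0) =
      ((d.motion j').1 : E4 ≃L[ℝ] E4) (E4.basisVector 0))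
    (hgrow : ∃ T, d.τ₀ ≤ T ∧ (d.background j').radius (d.motion j).2 ≤ d.excision j' T) :
    False := by
  obtain ⟨T, hT, hρ⟩ := hgrow
  set u : E4 := ((d.motion j).1 : E4 ≃L[ℝ] E4) (E4.basisVector 0) with hu
  have hu0 : u 0 ≠ 0 := lorentz_basisVector_zero_apply_zero_ne_zero _
  set s : ℝ := (T - (d.motion j).2 0) / u 0 with hs
  set y : E4 := s • u + (d.motion j).2 with hy
  have hy0 : y 0 = T := by
    simp only [hy, hs, PiLp.add_apply, PiLp.smul_apply, smul_eq_mul]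
    rw [div_mul_cancel₀ _ hu0]
    ring
  have hPj : poincareInv (d.motion j).1 (d.motion j).2 y = s • E4.basisVector 0 := by
    simp only [poincareInv, hy, add_sub_cancel_right, map_smul, hu,
      ContinuousLinearEquiv.symm_apply_apply]
  have hPj' : poincareInv (d.motion j').1 (d.motion j').2 y =
      s • E4.basisVector 0 + ((d.motion j').1 : E4 ≃L[ℝ] E4).symm ((d.motion j).2 - (d.motion j').2) := by
    have h1 : y - (d.motion j').2 = s • u + ((d.motion j).2 - (d.motion j').2) := by
      rw [hy]; abel
    simp only [poincareInv, h1, map_add, map_smul]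
    rw [hpar, ContinuousLinearEquiv.symm_apply_apply]
  have hrj : (d.background j).radius y = 0 := by
    show Kerr.radius (d.spin j) (poincareInv (d.motion j).1 (d.motion j).2 y) = 0
    rw [hPj]
    exact kerr_radius_smul_basisVector_zero _ _
  have hrj' : (d.background j').radius y = (d.background j').radius (d.motion j).2 := by
    show Kerr.radius (d.spin j') (poincareInv (d.motion j').1 (d.motion j').2 y) =
      Kerr.radius (d.spin j') (poincareInv (d.motion j').1 (d.motion j').2 (d.motion j).2)
    rw [hPj', kerr_radius_add_smul_basisVector_zero]
    rfl
  have h8 := S8 j' y (by rw [hy0]; exact hT) (by rw [hrj', hy0]; exact hρ)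
  have h12 := S12 j j' y hne (Or.inl (by rw [hy0]; exact hT))
    (by rw [hrj]; linarith [hR j ((d.background j).time y)])
  linarith

/-- The same, with the growth hypothesis in the form "the excision radius of `j'` tends to
infinity" (forced on every honest decomposition by flat convergence, since `Mⱼ' > 0`). -/
theorem false_of_parallel_boosts_of_tendsto {𝓢 : Spacetime.{0} 4} {O : Set 𝓢.carrier}
    (d : FinalStateDecomposition 𝓢 O 2) (R : Fin d.N → ℝ → ℝ)
    (hR : ∀ j s, -1 ≤ R j s)
    (S8 : ∀ j (y : E4), d.τ₀ ≤ y 0 → (d.background j).radius y ≤ d.excision j (y 0) →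
      (d.background j).radius y + 2 ≤ R j ((d.background j).time y))
    (S12 : ∀ j j' (y : E4), j ≠ j' → (d.τ₀ ≤ y 0 ∨ d.τ₀ ≤ (d.background j).time y) →
      (d.background j).radius y ≤ R j ((d.background j).time y) + 1 →
      R j' ((d.background j').time y) + 1 < (d.background j').radius y)
    {j j' : Fin d.N} (hne : j ≠ j')
    (hpar : ((d.motion j).1 : E4 ≃L[ℝ] E4) (E4.basisVector 0) =
      ((d.motion j').1 : E4 ≃L[ℝ] E4) (E4.basisVector 0))
    (hgrow : Tendsto (d.excision j') atTop atTop) : False :=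
  false_of_parallel_boosts d R hR S8 S12 hne hpar
    (((eventually_ge_atTop d.τ₀).and
      (hgrow.eventually_ge_atTop ((d.background j').radius (d.motion j).2))).exists)


/-! ## §2b Tightness: the growth hypothesis is necessary -/

/-- spatial norm is subadditive-ish: `‖c̄‖ − ‖ȳ‖ ≤ ‖(y − c)‾‖`. -/
theorem spatialNorm_sub_ge (y c : E4) :
    E4.spatialNorm c - E4.spatialNorm y ≤ E4.spatialNorm (y - c) := by
  unfold E4.spatialNorm
  rw [map_sub]
  have := norm_sub_norm_le (E4.spatial c) (E4.spatial y)
  rw [← norm_neg (E4.spatial y - E4.spatial c), neg_sub] at *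
  linarith [norm_sub_norm_le (E4.spatial c) (E4.spatial y), norm_sub_rev (E4.spatial c) (E4.spatial y)]

/-- **Tightness of `false_of_parallel_boosts`: the growth hypothesis cannot be dropped.**  Two
COMOVING Schwarzschild labels (`Λ₁ = Λ₂ = 1`, `a = 0`, axes at spatial distance `2R₀ + 20`) with
BOUNDED tubes `ρ ≡ R₀` and constant certified radii `R ≡ R₀ + 4` satisfy the coordinate clauses S8
and S12 (both orderings) and `R ≥ −1`: the contradiction of §2 genuinely needs one flat tube to
outgrow the distance between the parallel axes (physically forced, `ρ → ∞`, but not by S1–S12). -/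
theorem parallel_boosts_consistent_with_bounded_tubes (R₀ : ℝ) (hR₀ : 0 ≤ R₀) (c : E4)
    (hc : E4.spatialNorm c = 2 * R₀ + 20) :
    let r₁ : E4 → ℝ := fun y ↦ Kerr.radius 0 y
    let r₂ : E4 → ℝ := fun y ↦ Kerr.radius 0 (y - c)
    let ρ : ℝ → ℝ := fun _ ↦ R₀
    let R : ℝ → ℝ := fun _ ↦ R₀ + 4
    (∀ s, -1 ≤ R s) ∧
    (∀ (y : E4) (s s' : ℝ), r₁ y ≤ ρ s → r₁ y + 2 ≤ R s') ∧
    (∀ (y : E4) (s s' : ℝ), r₂ y ≤ ρ s → r₂ y + 2 ≤ R s') ∧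
    (∀ (y : E4) (s s' : ℝ), r₁ y ≤ R s + 1 → R s' + 1 < r₂ y) ∧
    (∀ (y : E4) (s s' : ℝ), r₂ y ≤ R s + 1 → R s' + 1 < r₁ y) := by
  simp only [Kerr.radius_zero_left]
  refine ⟨fun _ ↦ by linarith, fun y s s' h ↦ by linarith, fun y s s' h ↦ by linarith,
    fun y s s' h ↦ ?_, fun y s s' h ↦ ?_⟩
  · have := spatialNorm_sub_ge y c
    linarith
  · have h1 := spatialNorm_sub_ge (y - c) (-c)
    rw [sub_neg_eq_add, sub_add_cancel] at h1
    have h2 : E4.spatialNorm (-c) = E4.spatialNorm c := by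
      unfold E4.spatialNorm; rw [map_neg, norm_neg]
    linarith

/-! ## §3 From `Seamed` -/

/-- Projection of S1 (lower bound on the certified radii), S8 and S12 out of `Seamed`. -/
theorem Seamed.clauses {𝓢 : Spacetime.{0} 4} {O : Set 𝓢.carrier}
    {d : FinalStateDecomposition 𝓢 O 2} {R : Fin d.N → ℝ → ℝ} {R₀ : ℝ}
    (h : Seamed 𝓢 O d R R₀) :
    (∀ j s, R₀ + 4 ≤ R j s) ∧
    (∀ j (y : E4), d.τ₀ ≤ y 0 → (d.background j).radius y ≤ d.excision j (y 0) →
      (d.background j).radius y + 2 ≤ R j ((d.background j).time y)) ∧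
    (∀ j j' (y : E4), j ≠ j' → (d.τ₀ ≤ y 0 ∨ d.τ₀ ≤ (d.background j).time y) →
      (d.background j).radius y ≤ R j ((d.background j).time y) + 1 →
      R j' ((d.background j').time y) + 1 < (d.background j').radius y) := by
  obtain ⟨h1, -, -, -, -, -, -, h8, -, -, -, h12⟩ := h
  exact ⟨fun j s ↦ ((h1 j).2.2 s).1, h8, h12⟩

/-- **`Seamed` excludes comoving holes.** If `d` is SEAMED with `R₀ ≥ −5` (in the crux
`R₀' ≥ 100·Mᵢ > 0`), two distinct holes cannot have the same asymptotic four-velocity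
`Λⱼ∂₀ = Λⱼ'∂₀` when the excision radius of `j'` is unbounded (`→ ∞`; forced on honest
decompositions by flat `C²` convergence next to a hole of positive mass). Any proof of the crux must
therefore produce pairwise distinct asymptotic velocities — which its hypotheses do not provide. -/
theorem seamed_false_of_parallel_boosts {𝓢 : Spacetime.{0} 4} {O : Set 𝓢.carrier}
    (d : FinalStateDecomposition 𝓢 O 2) (R : Fin d.N → ℝ → ℝ) (R₀ : ℝ) (hR₀ : -5 ≤ R₀)
    (hS : Seamed 𝓢 O d R R₀) {j j' : Fin d.N} (hne : j ≠ j')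
    (hpar : ((d.motion j).1 : E4 ≃L[ℝ] E4) (E4.basisVector 0) =
      ((d.motion j').1 : E4 ≃L[ℝ] E4) (E4.basisVector 0))
    (hgrow : Tendsto (d.excision j') atTop atTop) : False := by
  obtain ⟨h1, h8, h12⟩ := hS.clauses
  exact false_of_parallel_boosts_of_tendsto d R (fun j s ↦ by linarith [h1 j s]) h8 h12 hne hpar
    hgrow

/-! ## §4 `¬ NecksCertify` modulo an equal-velocity binary -/

/-- **Hypothesis `H` (physics-level; not constructible in the tree): an equal-velocity binary with
honest charts exists.**  There are a connected `3`-manifold `X`, an admissible vacuum datum `D` on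
it, a maximal vacuum Cauchy development `𝒟` of `D`, and an honest `C⁴` final-state decomposition
`d` of `O = J⁺(ιX) ∩ I⁻(d.charted)` (`HonestCore ∧ HonestFar` at some `R₀` — verbatim the
antecedent of `NecksCertify`), such that EVERY `C²` final-state decomposition `d₂` of the same
exterior which is honest-core at some `R₀'` and SEAMED for some radii `R` has two distinct holes
with the same asymptotic four-velocity `Λᵢ∂₀ = Λⱼ∂₀` and has all excision radii tending to
infinity.  Intended inhabitant: a threshold ("parabolic") head-on two-black-hole recession — both
holes asymptotically at the centre-of-mass velocity, separation `∼ t^{2/3}` (admitted by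
`FinalStateDecomposition.tendsto_excision_div`; one atlas S6 pins `Λᵢ∂₀` to the physical
asymptotic velocity up to `o(t)` shears of the near-isometric flat chart, and `Mᵢ > 0` forces
`ρᵢ → ∞`).  Existence of such an MGHD with honest charts is open (codimension `≥ 1` in data, but
`NecksCertify` is pointwise in the datum).  Source of the witness: item evidence EVIDENCE.md of
`refuter-rattack-stmt-FinalStateConjecture-13549-0` (2026-08-15), §4.
[topic: Summits/FinalStateConjecture/FinalStateConjecture — final state, multi-black-hole
kinematics] -/
def EqualVelocityBinaryWitness : Prop :=
  ∃ (X : Type) (_ : TopologicalSpace X) (_ : ChartedSpace E3 X) (_ : IsManifold (𝓡 3) ∞ X)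
    (_ : ConnectedSpace X) (D : InitialDataSet (𝓡 3) X) (_ : D ∈ admissibleVacuumData X)
    (𝒟 : VacuumCauchyDevelopment D) (_ : 𝒟.IsMaximal) (O : Set 𝒟.carrier)
    (d : FinalStateDecomposition 𝒟.toSpacetime O 4) (R₀ : ℝ),
    O = exteriorOf 𝒟.toCauchyDevelopment d.charted ∧ HonestCore 𝒟.toSpacetime O 4 d R₀ ∧
      HonestFar 𝒟.toSpacetime O 4 d R₀ ∧
      ∀ (d₂ : FinalStateDecomposition 𝒟.toSpacetime O 2) (R : Fin d₂.N → ℝ → ℝ) (R₀' : ℝ),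
        O = exteriorOf 𝒟.toCauchyDevelopment d₂.charted → HonestCore 𝒟.toSpacetime O 2 d₂ R₀' →
          Seamed 𝒟.toSpacetime O d₂ R R₀' →
          (∃ i j : Fin d₂.N, i ≠ j ∧ ((d₂.motion i).1 : E4 ≃L[ℝ] E4) (E4.basisVector 0) =
            ((d₂.motion j).1 : E4 ≃L[ℝ] E4) (E4.basisVector 0)) ∧
          ∀ j, Tendsto (d₂.excision j) atTop atTop

/-- **`¬ NecksCertify` modulo `H = EqualVelocityBinaryWitness`** (negative lemma modulo `H`; the
crux item stays open, `H` is the construction it waits for).  Proof: apply the crux to the honest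
`C⁴` input of `H`; the resulting honest-core, seamed `C²` decomposition has `R₀' ≥ 100·Mᵢ > 0`,
two comoving holes and unbounded excision radii, contradicting `seamed_false_of_parallel_boosts`. -/
theorem necksCertify_false_of_equalVelocityBinaryWitness (hH : EqualVelocityBinaryWitness) :
    ¬ Theses.StarvedNecks.NecksCertify := by
  intro hS
  obtain ⟨X, _, _, _, _, D, hD, 𝒟, h𝒟, O, d, R₀, hO, hc, hf, hW⟩ := hH
  obtain ⟨d₂, R, R₀', hO₂, hc₂, hsm⟩ := hS X D hD 𝒟 h𝒟 O d R₀ hO hc hf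
  have hc₂' : HonestCore 𝒟.toSpacetime O 2 d₂ R₀' := hc₂
  have hsm' : Seamed 𝒟.toSpacetime O d₂ R R₀' := hsm
  obtain ⟨⟨i, j, hij, hpar⟩, hgrow⟩ := hW d₂ R R₀' hO₂ hc₂' hsm'
  have hR₀' : -5 ≤ R₀' := by
    have h1 := (hc₂'.1 i).2.1
    have h2 := d₂.mass_pos i
    linarith
  exact seamed_false_of_parallel_boosts d₂ R R₀' hR₀' hsm' hij hpar (hgrow j)

/-! ## §5 Two typed consequences of `Sm` (generation 2) -/

/-- **S7 pins the late flat domain.**  Together with the structure field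
`setOf_lt_excision_subset_flatDomain`, clause S7 of `Sm` makes the flat-late coordinate domain
EQUAL to the complement of the flat tubes: `U₀ ∩ {y⁰ > τ₀} = {y⁰ > τ₀, ∀ j, ρⱼ(y⁰) < rⱼ(y)}`.  So the
seam's prover has no freedom in `flatDomain` above `τ₀` — only at `y⁰ ≤ τ₀`, where S6 at `y⁰ = τ₀`
(non-strict!) still needs the collar `{ρᵢ(τ₀) < rᵢ ≤ Rᵢ + 1}` inside `flatDomain` (an open set: take
e.g. `{y⁰ > τ₀ − 1, rⱼ > ρ̃ⱼ(y⁰)}` with a continuous extension `ρ̃` of `ρ`, REVIEW_R2). -/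
theorem flatDomain_late_eq {𝓢 : Spacetime.{0} 4} {O : Set 𝓢.carrier}
    (d : FinalStateDecomposition 𝓢 O 2)
    (S7 : ∀ y : d.flatDomain, d.τ₀ ≤ y.1 0 → ∀ j, d.excision j (y.1 0) < (d.background j).radius y.1) :
    {y : E4 | d.τ₀ < y 0 ∧ y ∈ (d.flatDomain : Set E4)} =
      {y : E4 | d.τ₀ < y 0 ∧ ∀ j, d.excision j (y 0) < (d.background j).radius y} := by
  ext y
  simp only [mem_setOf_eq]
  constructor
  · rintro ⟨hy, hU⟩
    exact ⟨hy, S7 ⟨y, hU⟩ hy.le⟩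
  · rintro ⟨hy, hr⟩
    exact ⟨hy, d.setOf_lt_excision_subset_flatDomain ⟨hy, hr⟩⟩

/-- **S9 collapses the disjunction near certified tubes.**  Clock lag (S9) makes "hole-late within
`Rⱼ(tⱼ y) + 2` of hole `j`" imply "flat-late": this is why the disjunction `τ₀ ≤ tⱼ y ∨ τ₀ ≤ y⁰` in
S4/S5/S12 is effectively `τ₀ ≤ y⁰` there, and why hole-late points near the collar's outer edge
(`rⱼ ≤ Rⱼ + 2`) are never flat-early — the margin that lets the far-leaf fold of §E be the identity
on a neighbourhood of the collar. -/
theorem flatLate_of_holeLate {𝓢 : Spacetime.{0} 4} {O : Set 𝓢.carrier}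
    (d : FinalStateDecomposition 𝓢 O 2) (R : Fin d.N → ℝ → ℝ)
    (S9 : ∀ j (y : E4), d.τ₀ ≤ (d.background j).time y →
      (d.background j).radius y ≤ R j ((d.background j).time y) + 2 → (d.background j).time y ≤ y 0)
    {j : Fin d.N} {y : E4} (ht : d.τ₀ ≤ (d.background j).time y)
    (hr : (d.background j).radius y ≤ R j ((d.background j).time y) + 2) : d.τ₀ ≤ y 0 :=
  ht.trans (S9 j y ht hr)

/-! ## §6 Index of the LANDED negative lemmas (imported; generation 1 + 2) -/

/-- gen 1 (p73407): `¬ NecksCertify` modulo the equal-velocity binary. -/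
example : Theorems.NecksCertify.Negative.EqualVelocityBinaryWitness → ¬ Theses.StarvedNecks.NecksCertify :=
  Theorems.NecksCertify.Negative.NecksCertify_false_of_EqualVelocityBinaryWitness

/-- gen 2 (p76706): the Bargmann threshold of the picked line's rung M2 cannot be relaxed to
`2 log 2` (parked Pöschl–Teller resonance; §T.4). -/
example : ¬ Theorems.NecksCertify.Negative.NoParkingDecayUpTo (2 * Real.log 2) :=
  Theorems.NecksCertify.Negative.not_noParkingDecayUpTo_two_mul_log_two

/-- gen 2 (p76706): `NoParkingDecayUpTo η₀` (`η₀ ≥ 1`) is a strengthening of M2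
(`NoParkingDecayBelow 1`, which is the line file's `NoParkingDecay` verbatim, `Iff.rfl`). -/
example {η₀ : ℝ} (h₀ : 1 ≤ η₀) (h : Theorems.NecksCertify.Negative.NoParkingDecayUpTo η₀) :
    Theorems.NecksCertify.Negative.NoParkingDecayBelow 1 :=
  Theorems.NecksCertify.Negative.noParkingDecayBelow_one_of_noParkingDecayUpTo h₀ h

/-- gen 2 (p75778): the zero-energy equation of the resonance, `th″ = (−2/cosh²)·th`. -/
example (x : ℝ) : Theorems.NecksCertify.Negative.PoschlTeller.th₂ x =
    (-2 / Real.cosh x ^ 2) * Theorems.NecksCertify.Negative.PoschlTeller.th x :=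
  Theorems.NecksCertify.Negative.PoschlTeller.th₂_eq x

/-- gen 2 (p75778): the Bargmann norm of the Pöschl–Teller well is exactly `2 log 2`. -/
example : ∫ s in Set.Ioi 0, (s - 0) * Theorems.NecksCertify.Negative.PoschlTeller.ptMajorant s =
    2 * Real.log 2 :=
  Theorems.NecksCertify.Negative.PoschlTeller.integral_bargmann

/-! ## §T TARGETS — the six registered stubs of the picked line (generation 2, cycle 1)

Skeleton `Lines/bargmann-small-late-exterior.lean` (lead `prover-line-stmt-FinalStateConjecture-13549-r-0`,
sha 7cb29291…): `NecksCertify_of : R1 → R2 → (R1 → R2 → M1) → (R1 → R2 → M2) → (M1 → M2 → N1) → N2 →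
NecksCertify`.  Payload `targets`/`stuck_stubs` were EMPTY at this cycle; the stubs were attacked
proactively.  Verdicts (paper unless a theorem is named):

§T.1  R1 `stub_tonelliBargmann` = `TonelliBargmann` — TRUE.  `ν` continuous on `Ici R₀` is bounded
near `R₀`, and `ν ≤ (s − R₀)ν` on `s ≥ R₀ + 1`, so `ν ∈ L¹(Ioi R₀)`; nonnegativity/antitonicity of
`I_L(ρ) = ∫_{ρ+L}^∞ ν` are immediate from `ν ≥ 0` (`ρ + L ≥ R₀`); the double-integral clause is
Tonelli: `∫_{R₀}^{r} I_L(ρ) dρ = ∫_{s > R₀+L} ν(s)·(min(s − L, r) − R₀)⁺ ds ≤ ∫_{s>R₀+L} (s − R₀)ν(s) ds`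
(the weight `(min(s−L,r) − R₀)⁺ ≤ s − L − R₀ ≤ s − R₀`); both tails tend to `0` by integrability
(`tendsto_setIntegral_Ioi`-type facts).  No edge case: for `r = R₀` the interval integral is `0`.

§T.2  R2 `stub_characteristicCalculus` = `CharacteristicCalculus` — TRUE.  For `φ ∈ C²(ℝ²)`,
`w = φ_t + φ_r`, `z = φ_t − φ_r` are `C¹` and `d/ds w(t−s, r+s) = −w_t + w_r = −(φ_tt − φ_rr)`
(Schwarz), `d/dσ φ(t−σ, r−σ) = −w`, `d/dσ z(t−σ, r−σ) = −(φ_tt − φ_rr)`; the typed slices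
`deriv (fun s ↦ ψ s r − χ s r) t` etc. are these partials for `C²` functions (the tree's dictionary
`Theorems/PhotonSphereChannelsBlindnessWaveCalculus`).  Data facts: `φ(T,·) = 0` on the CLOSED
half-line `[R₀, ∞)` and `φ_t(T,·) = 0` there give `φ_r(T, r) = 0` INCLUDING `r = R₀` (two-sided
`deriv` of a `C¹` function vanishing on `[R₀,∞)` vanishes at `R₀` by continuity of the derivative),
hence `w = z = 0` on the slab; `φ(·, R₀) = 0` on `[T, ∞)` gives `φ_t(t, R₀) = 0` for `t ≥ T`
(including `t = T`), i.e. `z = −w` on the cylinder.  All three identities are stated for ALL real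
`t r a` (no region) — correct, they are global calculus facts for `C²` functions on `ℝ²`.

§T.3  M1 `stub_bargmannSupContraction` — TRUE, with two UNNECESSARY hypotheses (information for the
prover, not a defect): (a) `0 ≤ R₀` is never used — the Tonelli bound
`∫_{R₀}^{r} dρ ∫_ρ^∞ ν ≤ ∫ (s − R₀)ν` holds for every real `R₀` (TRIAGE-r1-1's "needs `R₀ ≥ 0`" came
from bounding the outgoing segment length by `r` instead of `r − R₀`); (b) the a-priori bound
`∃ P, |ψ| ≤ P on Ω` is DERIVABLE: `|χ| ≤ C` on `Ω ⊇ {t = T}` bounds the data, finite speed of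
propagation bounds `ψ` on each `Ω ∩ {t ≤ τ}`, and the contraction run on `Ω ∩ {t ≤ τ}` (closed under
the backward characteristics used) gives `sup_{Ω∩{t≤τ}} |ψ| ≤ C/(1 − η)` for every `τ`.  The
registered statement (with both hypotheses) is of course the one to prove.  Edge cases checked:
`η < 0` is vacuous (`|V| ≤ ν` forces `ν ≥ 0`, so `∫ ≥ 0`), `C < 0` vacuous (`Ω ≠ ∅`).

§T.4  M2 `stub_noParkingDecay` — TRUE for `η < 1` (splitting the double integral at `s − ρ = L`:
`N(u) ≤ N_χ(u) + η·N(u − 2L) + P·∫_{R₀+L}^∞ (s − R₀)ν`, so `lim N ≤ η·lim N`; then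
`|w| ≤ N(u − 2L)∫ν + P∫_{R₀+L}^∞ ν` and `|z| ≤ |w(foot)| + N(u)∫ν`, the source points of `z` having
the SAME retarded time; again `0 ≤ R₀` and `|ψ| ≤ P` are unnecessary, as in §T.3 — `χ → 0` on
`{t − r ≥ u₀}` forces the data to be bounded at `i⁰`, hence `χ` bounded on `Ω`).  SHARPNESS
(kernel-checked, `Negative/NoParkingDecaySharp.lean`): `NoParkingDecayUpTo η₀` := M2 with `η < 1`
replaced by `η ≤ η₀`; `not_noParkingDecayUpTo_two_mul_log_two : ¬ NoParkingDecayUpTo (2 log 2)`.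
Witness: `R₀ = T = 0`, `V = −2 sech² r` (Pöschl–Teller; Bargmann norm `∫₀^∞ 2s sech² s ds = 2 log 2`,
evaluated exactly through the primitive `2(s tanh s − log cosh s)`), `ψ = tanh r` (the zero-energy
Dirichlet resonance: static, `|ψ| ≤ 1`, `ψ(t,0) = 0`, `ψ(t,2) = tanh 2 > 1/2` forever),
`χ = (tanh(r+t) + tanh(r−t))/2 → 0` on `{t − r ≥ u₀}`.  So "no parking" is exactly the absence of a
zero-energy resonance of the tail potential, which Bargmann `< 1` buys and `≥ 2 log 2` does not;
whether the threshold is exactly `1` is open here (a resonance needs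
`sup|f| ≤ ∫∫|V| sup|f| = η sup|f|`, strict for continuous `ν`; the corner profile `min(r − R₀, K)`
realises `η = 1` with a δ-well).  CONSEQUENCE for N1: per-mode use of M1/M2 is limited to couplings
of Bargmann norm `< 1`; for Regge–Wheeler `η_ℓ = 2M(ℓ(ℓ+1)+3)/R₀` that is `ℓ ≤ 6` at `R₀ = 100M`
(TRIAGE-r1-1), and for `ℓ ≥ 7` the obstruction is real (attractive wells of norm `> 1` park static
hair), so the high-`ℓ` sector genuinely needs the positivity/WKB route the skeleton names — it
cannot be obtained by enlarging `R₀` either, since `η_ℓ < 1 ∀ ℓ` is impossible at any fixed `R₀`.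

§T.5  N2 `stub_seamSurgery` — NOT killed, but FALSE MODULO the analogue of `H`: `NeckAtlas d R₀`
(A1–A8) says nothing that separates two holes (no analogue of S12, no `Rg → ∞`, no image-disjointness),
so for an input with two comoving holes carrying a `NeckAtlas` the conclusion `Seamed d₂ R R₀'` is
unsatisfiable by `seamed_false_of_parallel_boosts` (§3) as soon as every seamed output has a
comoving pair with an unbounded excision radius — i.e. `H₂ → ¬SeamSurgery` with
`H₂ := ∃ (honest C⁴ input with a NeckAtlas) ∀ (honest-core seamed C² output), comoving pair ∧ ρ → ∞`,
same proof as §4.  Not filed separately (it is §4 with one more unused hypothesis); the lead already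
plans to move the separating clauses into `NeckAtlas` or to thread repair C′ (distinct 3-velocities)
through `HonestCore`, after which S12 for `d₂` is pure coordinate geometry (linear separation of
non-parallel axes against sublinear `R`, `ρ`; choose `τ₀'` late).  Typed remarks for the N2 prover:
(i) `d₂.chart i` must be smooth on the WHOLE boosted Kerr domain (`IsLateChart.contMDiff`), while A1
gives smoothness of `Ψ'ᵢ` only on `U = {τ₁ < tᵢ, rᵢ < Rgᵢ + 2}` and A3 prescribes `Ψ'ᵢ = Φ` at
flat-late/hole-EARLY collar points with no smoothness — the chart must be re-defined below hole time
`τ₁` (free, but S4/S5 still bite at flat-late/hole-early points INSIDE the flat tube with `rᵢ ≥ R₀'`,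
whose hole times are ≥ `τ₀' − v(Rᵢ(·) + ρᵢ(·) + |aᵢ| + 2)` — choose `τ₀'` so late that these exceed
`τ₁`); (ii) choose `τ₁ > τ₀` strictly in N1 (A3 needs `y ∈ flatDomain` at `y⁰ = τ₁`, and the structure
only gives `{y⁰ > τ₀}`); (iii) `Rg` may be taken LARGE at early hole times for free (only lower bounds
and sublinearity at `+∞` constrain it), which is what A5 at `y⁰ = τ₁` needs for fast holes.

§T.6  N1 `stub_lateExteriorNoParking` — the physics (exterior characteristic Kerr stability with
certified inner cylinders); nothing cheap applies.  Two load-bearing facts it must produce that no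
model rung sees: the scale-invariant smallness of the NONLINEARLY generated incoming radiation
(§F), and the `C²` control two derivatives below the input's `C⁴` (M1/M2 are `C⁰`/`C¹` statements).

## §E  The far-leaf fold versus `Hc`(2)/`Hc`(3) (generation 2; boosted hole, flat frame = frame of `Σ`)

Setting: one hole boosted with velocity `v = v ê₁` (`0 < v < 1`, `γ`) in the flat chart's frame;
comoving coordinates `(s, x̄′)`, `y = Λ(s, x̄′) + c`, flat time `y⁰ = γ(s + v x′¹) + c⁰`.  WHY A FOLD
IS FORCED: the hole chart's late region `{s > τ₀}` contains far-leaf points BEHIND the hole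
(`x′¹ ≪ 0`) whose flat time is `< τ₀`, even `< 0`; mapped identically they would leave `J⁺(Σ)` (`Σ`
sits at flat height `O(log r)`), contradicting `IsLateChart.image_subset`, and S10 demands they lie in
the radiation zone `Φ({y⁰ > τ₀} ∖ tubes)`.  So `Ψᵢ := Φ ∘ G` on far leaves with
`G(s, x̄′) = (s + γΔ⁰, x̄′ − γvΔ⁰ ê₁)` (push by `Δ⁰ ≥ 0` along the FLAT time axis `Λ⁻¹e₀ = γ(1, −v ê₁)`).
CONSTRAINTS and how they are met: (1) flat-late image: `Δ⁰ > (τ₀ − c⁰ − γs − γv x′¹)⁺ =: P_s(x′¹)`;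
(2) `G = id` near the collar `{|x̄′| ≤ R(s) + 2}` (smooth gluing with one atlas; hole-late points there
are flat-late by S9, `flatLate_of_holeLate`); (3) `Hc`(2) for the OUTPUT — every pushed point must lie
in `J⁻` of the pushed later discs `{tᵢ = τ₂, rᵢ ≤ ϱ}` for ALL `τ₂ > s`, `ϱ > rᵢ`: since the disc through
hole time `τ₂` contains the same comoving position, it suffices that the comoving world-lines
`s ↦ G(s, x̄′)` be future causal, i.e. `1 + γ∂ₛΔ⁰ ≥ γv|∂ₛΔ⁰|`, i.e. `∂ₛΔ⁰ ≥ −γ(1 − v)` (pushes may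
DECREASE in hole time, but no faster than `γ(1−v)`; the naive "minimal push" `P_s` decreases at rate
`γ` — too fast — which is the near-miss behind gen 1's one-line remark); (4) injectivity of `G`:
along each line parallel to `u = γ(1, −vê₁)`, `1 + u·∇Δ⁰ > 0`.  SOLUTION:
`Δ⁰(s, x̄′) := n(A(x′¹) − γ(1−v)(s − τ₀))`, `A := τ₀ − c⁰ − γτ₀ − γv x′¹`, with `n` smooth, `n = 0` on
`(−∞, −1]`, `0 ≤ n′ < 1`, `n(u) > u⁺` on `(−1, ∞)` (e.g. `n(u) = ∫_{−1}^{u} σ`, `σ` rising fast from `0`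
towards `1` with `∫(1 − σ) < 1`).  Then (3) holds with equality margin, (1) holds because
`n(A − γ(1−v)(s−τ₀)) ≥ n(A − γ(s − τ₀)) > (A − γ(s−τ₀))⁺ = P_s`, (4) holds because
`u·∇[A − γ(1−v)(s − τ₀)] = γ²(v² + v − 1)` and `n′γ²(1 − v − v²) < 1`, and (2) reduces to the two
SIDE CONDITIONS `c⁰ ≥ τ₀(1 − γ) + γv(R(τ₀) + 3) + 1` (the clock offset, as gen 1/REVIEW_R2 up to the
margin) and `R(s) ≤ R(τ₀) + (1 − v)(s − τ₀)/v` for `s ≥ τ₀` (certified radius of a fast hole must grow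
slower than slope `(1−v)/v` — free, `R` is the seam's sublinear choice).  `Hc`(3) with the fold:
pushed points with hole time `→ ∞` have flat time `≥ τ₀ + γv(s − τ₀) + const → ∞`, so they do not
accumulate in `O` granted the honest flat clock; limits at bounded hole time are handled as without
the fold.  CONCLUSION: no clause of `Hc`/`Sm` is violated by honest boosted single holes; the fold's
two side conditions are the only new bookkeeping and both are satisfiable.  (The same fold is needed
by the INPUT's charts in G — `HonestFixedRadiusSettling` — for every boosted hole, since the flat
chart's frame is pinned to `Σ`'s asymptotic rest frame by `image ⊆ J⁺(Σ)` plus whole-slab `C²`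
convergence; admissible data have zero ADM momentum, `k = o(r⁻²)`, so that frame is the CM frame and
a single recoiling hole already has `Λ ≠ 1`.)

## §F  Why the kill criterion is out of cheap reach (generation 2)

(1) DATA-BORNE PACKET TRAINS (TRIAGE-r1-1 §B(3)–(4)) give finite-energy linear waves on Minkowski
`{r ≥ R₀}` with `Cᵏ` decay on every fixed slab and no decay on a sublinear neck — a model-level
non-starving neck, fatal for the linear transfer `C⁺_lin` but NOT for the crux, whose input certifies
more: a packet with focal `C²` size `O(1)` at pericentre `bₙ ≤ ρ(tₙ)` at time `tₙ` from data at radius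
`∼ tₙ` needs frequency `ωₙ ≫ tₙ²/κ` by the admissible `o₂(r⁻¹)` fall-off (`|∂²h| = o(r⁻³)` with energy
`Eₙ ∼ κ tₙ² ωₙ Aₙ²`, focal `sup² ≈ κEω`), while the input's `C⁴` flat certificate at tube entry
(radius `ρₙ`, amplitude focused by `tₙ/ρₙ`) needs `ωₙ ≪ κρₙ`; together `ρₙ ≫ tₙ²/κ²`, impossible for
sublinear `ρ` (re-derived here; even focal `C⁰` size `O(1)` fails: it needs `ωₙ ≪ κ/tₙ² → 0`, not a
packet).  (2) TAILS: any polynomially decaying tail `τ^{−p}` has scale-invariant size `r|∂φ| → 0` on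
`{r ≤ τ^{1−ε}}`; Price/Luk–Oh (arXiv:2404.02220) tails decay polynomially (possibly slower than linear
Price law, never `O(1)`).  (3) HIDDEN COMPANIONS in the neck are excluded by `Hf`(3) (gen 1 §D degree
argument, re-checked: the image of the coordinate shell `{R₀ ≤ rᵢ ≤ 2D}` under a `10%`-near-isometric
embedding is the physical region between its boundary spheres, which would contain the companion's
horizon, not in `O`).  (4) What is left — nonlinearly generated radiation persistently refocused into
the neck with scale-invariant `C³` size `↛ 0` while every fixed radius converges — is not
kit-computable and has no printed instance; it is exactly N1.
-/

/-! ## §G  Generation 3 (cycle 1): growth theorem, `H′`, threshold `1`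

(G1) `Theorems.NecksCertify.Negative.excision_tendsto_atTop_of_seamed`
(`Negative/SeamedExcisionUnbounded.lean`; toolkit `Negative/SeamedOneAtlasDeviation.lean`:
`kerr_radius_axis`, `scalarH_axis`, `rPlus_le_two_mul`,
`norm_deviation_le_of_supCkENorm_le`, `deviation_sub_deviation_of_agree`,
`abs_sub_bilin_le_of_agree`, `boostedKerrBilin_sub_bilin_lorentz_basisVector_zero`).  STATEMENT:
```
theorem excision_tendsto_atTop_of_seamed (d : FinalStateDecomposition 𝓢 O k) (R : Fin d.N → ℝ → ℝ) (R₀ : ℝ)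
    (hc1 : ∀ i, Kerr.IsSubextremal (d.mass i) (d.spin i) ∧ 100 * d.mass i ≤ R₀ ∧ 0 < Λᵢ ∂₀ 0)
    (S1 : ∀ i, Continuous (R i) ∧ ∀ s, R₀ ≤ d.excision i s) (S6) (S7) (S8) (S12) (j : Fin d.N) :
    Tendsto (d.excision j) atTop atTop
```
(S6, S7, S8, S12 verbatim the clauses of `Sm`, in the `d.background` form of §1's `Seamed`).  WHAT IT
USES of the structure: `tendsto_truncDeviationCk j (b+1)` (near zone of hole `j` at ONE fixed
radius), `tendsto_deviationCk_flat` (whole flat slabs), `setOf_lt_excision_subset_flatDomain`,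
`isLateChart*.contMDiff`, `mass_pos`.  WHAT IT DOES NOT USE: S2–S5, S9–S11, monotonicity of `R`,
sub-extremality.  READING: (i) for the N2 prover — `ρ'ᵢ → ∞` is forced on every seamed output, and
the proof shows WHY quantitatively: at an S6-eligible point of `j`-radius `λ` the flat `C⁰` deviation
is at least `2H − (hole deviation) ≈ 2Mⱼ/λ`, so S3's `1/10` needs `λ ≳ 20Mⱼ‖Λⱼ∂₀‖²` at the wall
from `τ₀'` on (consistent with REVIEW_R2's `ρ ≥ 80M‖Λ‖⁴`); (ii) for the disprover — `H` of §4 sheds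
its growth conjunct (G2).  TIGHTNESS (gen 1 §2b `parallel_boosts_consistent_with_bounded_tubes`):
S8/S12 alone allow bounded tubes; it is S6 + convergence that forbid them.

(G2) `Theorems.NecksCertify.Negative.ComovingPairWitness` (`H′`),
`NecksCertify_false_of_ComovingPairWitness : H′ → ¬ NecksCertify`,
`comovingPairWitness_of_equalVelocityBinaryWitness : H → H′`
(`Negative/NecksCertifyFalseOfComovingPairWitness.lean`, filed `--negative-modulo ComovingPairWitness`).
`H′` = ∃ admissible `X, D`, MGHD `𝒟`, honest `C⁴` input `(O, d, R₀)` (`Hc ∧ Hf`, `O = exteriorOf`)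
such that EVERY `C²` `d₂` of `O` with `O = exteriorOf 𝒟 d₂.charted`, `Hc d₂ R₀'`, `Sm d₂ R R₀'` has
`i ≠ j` with `Λᵢ∂₀ = Λⱼ∂₀`.  WHY `H′` IS STILL PHYSICS (and cannot be shed in the tree): nothing typed
ties the OUTPUT's labels `(Λᵢ, cᵢ)` to the input's; label rigidity (one atlas pins `Λᵢ∂₀` to the
physical asymptotic velocity of hole `i`, gen 1 §D) is a statement about honest charts of a
two-black-hole MGHD, which the tree cannot construct.  Intended inhabitant unchanged: the threshold
("parabolic") recession.  Repair C′ unchanged.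

(G3) `Theorems.NecksCertify.Negative.not_noParkingDecayUpTo_of_one_lt : 1 < η₀ → ¬ NoParkingDecayUpTo η₀`,
`noParkingDecayUpTo_threshold : NoParkingDecayUpTo η₀ → η₀ ≤ 1`
(`Negative/NoParkingThresholdOne.lean`; toolkit `Negative/NoParkingShelf.lean`, namespace `….Shelf`:
`S = Real.smoothTransition`, `S' = deriv S`, primitive `primStep`, profile `prof K`, `prof₁`, `prof₂`,
majorant `nu K`, potential `pot K`, `integral_nu : ∫_{(0,∞)} ν = 1/K`,
`integral_bargmann_le : ∫ (s−0)ν ≤ (K+1)/K`, `chi_vanish`, `abs_pot_le_nu`, `pot_mul_prof`).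
WITNESS in one line: `R₀ = T = 0`, `K = max 1 (1/(η₀ − 1))`, `ψ(t,r) = prof K r`
(`= (r − primStep(r−K) + primStep(−r−K))/K`: odd, `= r/K` on `[0,K]`, `≥ 1` on `[K,∞)`, constant on `[K+1,∞)`),
`V = prof''/prof` (supported in the shell `[K, K+1]`, attractive), `ν = S'(r−K)/K`,
`χ = (prof K (r+t) + prof K (r−t))/2 ≡ 0` on `{t − r ≥ K+1}`, `ψ(t, K) = 1 > 1/2`.  So the lever
"Bargmann norm `η` ⇒ rate-free no-parking" holds EXACTLY for `η < 1` (M2, proved by the worker) and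
fails for every `η > 1`; `η = 1` itself (continuous `ν`) is the only open point and is immaterial.
For N1: per-mode contraction on Regge–Wheeler couplings `η_ℓ = 2M(ℓ(ℓ+1)+3)/R₀` is available iff
`η_ℓ < 1` — `ℓ ≤ 6` at `R₀ = 100M` — with no slack; the high-`ℓ` sector needs `V_RW ≥ 0`/WKB as the
skeleton says (a POSITIVE shell has no zero-energy resonance: for `V ≥ 0` the Dirichlet zero-energy
solution is convex where positive and cannot turn over, so (G3)'s mechanism does not transfer to
repulsive couplings — consistent with the skeleton's plan, recorded so nobody tries to "refute" the
high-`ℓ` closure with a shelf).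

WHY THE CRUX STILL RESISTS (gen 3 summary for the lead): unchanged in kind — no constructible
black-hole MGHD, `N = 0` satisfiable — but sharper in content: the comoving defect is now
`H′ → ¬NecksCertify` with `H′` purely kinematic, and every other clause has a kernel-checked or
re-derived consistency witness.  Next regimes if re-armed: the lead's stuck stubs (none registered at
this cycle); a `NeckAtlas` analogue of (G1) is possible only with a tube-separation clause (NeckAtlas
has none — two `ρ'`-tubes may overlap, which is harmless for satisfiability).
-/

end Summit.FinalStateConjecture.FinalStateConjecture.Cruxes.NecksCertify.Disproof

end
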